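import Summits.BirchSwinnertonDyer.BirchSwinnertonDyer.Theorems.ManinLocalTwoThreeStevensNaturalTes75
import Summits.BirchSwinnertonDyer.BirchSwinnertonDyer.Theorems.ManinLocalTwoThreeStevensCurveConsumers
import Summits.BirchSwinnertonDyer.BirchSwinnertonDyer.Theorems.ManinLocalTwoThreeManinOddAtFourOfCDT
import Summits.BirchSwinnertonDyer.BirchSwinnertonDyer.Theorems.ManinLocalTwoThreeCDivisionIntegralCDT
import Summits.BirchSwinnertonDyer.BirchSwinnertonDyer.Theorems.ManinLocalTwoThreeCDivisionNeronPeriodsConsumers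
import Literature.NumberTheory.EllipticCurves.ManinConstantModularDegree
import HarnessLib

/-!
# C2 `ManinOddAtFour` (stmt-BirchSwinnertonDyer-22967) — state probe and the CDT-free residual, by name (ideator bsd-idea-19 g43, lens dual)

PROBE FILE (folder-only; publish via `ledger crux write`, never proposed — W-71).  Nothing new is proved about elliptic curves here:
every theorem is a COMPOSITION of tree theorems landed by cell bsd-f2-manin on 2026-08-30 (08:34Z–09:25Z), recorded so that the
director's ledger can quote kernel-checked facts instead of memo prose.

* §1  the index-4 world E-an-152b `ShimuraIndexNeFourAtFour` and `Gamma1PeriodsNotInsideTwiceGamma0Periods` hold modulo MODULARITY alone;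
* §3  the PRINTED CDT-free regime of C2, by name: at conductor level with `8 ∤ N`, odd modular degree and `c ≠ 0`, the ČNS fact
      `v₂(c) ≤ v₂(deg φ)` [ČNS 2020 Thm 1.2] gives `2 ∤ c` (composition; the fact is a hypothesis);
* §2  the CDT-free residual of C2 is typed: `HalfManinForcesGamma1InsideTwice` («for a lattice-optimal `X₀(N)`-datum with `4 ∣ N`, `2 ∣ c`
      forces `Λ₁(f) ⊆ 2Λ₀(f)`»); C2 BY NAME follows from it WITHOUT CDT (modularity is C2's own fourth hypothesis); and it follows from the
      cell's E-an-250 `Gamma1PeriodsInNeronLattice` («Stevens I strong», itself ⟸ CDT by `gamma1PeriodsInNeronLattice_of_CDTInt`).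
HONEST FRAMING: C2 stays OPEN as filed; Manin's conjecture and BSD are NOT proved; no summit statement is proved by this seat.
-/

set_option autoImplicit false
-- lint-debt: the directory name repeats the summit name (sibling precedent `Cruxes/ManinOddAtFour/Lines/kummer_diamond.lean`)
set_option linter.dupNamespace false

noncomputable section

open Literature.NumberTheory.EllipticCurves Literature.NumberTheory.EllipticCurves.ModularForms
open Literature.NumberTheory.Automorphic
open Summit.BirchSwinnertonDyer.Rank1Residual.ManinAdditive
open Summit.BirchSwinnertonDyer.BirchSwinnertonDyer.Theorems
open Summit.BirchSwinnertonDyer.BirchSwinnertonDyer.Theorems.ManinLocalTwoThree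

namespace Summit.BirchSwinnertonDyer.BirchSwinnertonDyer.Cruxes.ManinOddAtFour.DualResidualG43

/-! ## §1 The index-4 world is closed modulo modularity (compositions) -/

/-- E-an-152b BY NAME ⟸ modularity alone: the cyclicity road with T-es-75 discharged by the cell's theorem. -/
theorem shimuraIndexNeFourAtFour_of_modularity (hnf : exists_isNewformOf) : ShimuraKernel.ShimuraIndexNeFourAtFour :=
  StevensCurve.shimuraIndexNeFourAtFour_of_modularity_Tes75_viaCyclicity hnf
    StevensGalois.optimalGamma1Parametrization_cuspInv_galoisAction_holds

/-- desc g26 row 1 BY NAME ⟸ modularity alone: `Λ₁(f) ⊄ 2Λ₀(f)` for every `X₀(N)`-datum. -/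
theorem gamma1PeriodsNotInsideTwice_of_modularity (hnf : exists_isNewformOf) :
    ShimuraCyclic.Gamma1PeriodsNotInsideTwiceGamma0Periods :=
  ShimuraCyclic.notInsideTwice_of_shimuraKernelCyclic (StevensGalois.shimuraKernelCyclic_of_modularity hnf)

/-! ## §2 The CDT-free residual of C2, typed, with both directions by name -/

/-- **R₂ `HalfManinForcesGamma1InsideTwice`** — what the unbounded-denominators theorem buys on C2 and nothing else: for a lattice-optimal
`X₀(N)`-datum of a globally minimal curve with `4 ∣ N`, an even Manin constant forces the `Γ₁(N)`-periods of `f` into `2Λ₀(f)`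
(equivalently: the `(ℤ/2)²`-cover of `X₀(N)` pulled back from `[2]` on the optimal curve contains `Γ₁(N)`).  Nothing asserted. -/
@[conjecture] def HalfManinForcesGamma1InsideTwice : Prop :=
  ∀ (W : WeierstrassCurve ℚ) [W.IsElliptic] [W.IsGloballyMinimal] {N : ℕ} [NeZero N]
    (D : ModularParametrizationData W N),
    (∀ z ∈ D.L.lattice, ∃ w ∈ periodLattice D.f, z = D.c * w) → 2 ^ 2 ∣ N → (2 : ℤ) ∣ D.maninConstant →
    ∀ z ∈ periodLatticeGamma1 D.f, ∃ w ∈ periodLattice D.f, z = 2 * w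

/-- **C2 BY NAME ⟸ R₂, CDT-free** (the three printed semistable facts are unused; modularity — C2's own fourth binder — feeds the
cyclicity theorem of the cell). -/
theorem maninOddAtFour_of_halfManinForcesGamma1InsideTwice (hR : HalfManinForcesGamma1InsideTwice) :
    Summit.BirchSwinnertonDyer.BirchSwinnertonDyer.Theses.ManinLocalTwoThree.ManinOddAtFour := by
  intro _hMz _hAU _hCes hnf W _ _ N _ D hopt h4 h2
  exact gamma1PeriodsNotInsideTwice_of_modularity hnf W D (hR W D hopt h4 h2)

/-- **R₂ ⟸ E-an-250 `Gamma1PeriodsInNeronLattice`** («`Λ₁(f) ⊆ Λ_W` for every `X₀(N)`-datum»; the cell derives E-an-250 from CDT in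
`gamma1PeriodsInNeronLattice_of_CDTInt`): with `Λ_W = cΛ₀(f)` and `2 ∣ c`, `Λ₁ ⊆ cΛ₀ ⊆ 2Λ₀`. -/
theorem halfManinForcesGamma1InsideTwice_of_gamma1PeriodsInNeronLattice
    (h250 : CDivisionNeron.Gamma1PeriodsInNeronLattice) : HalfManinForcesGamma1InsideTwice := by
  intro W _ _ N _ D hopt _h4 h2 z hz
  -- `Λ₁(f) ⊆ Λ(D.L)` from E-an-250 via the closure lemma of the cell
  have hle : ∀ z ∈ periodLatticeGamma1 D.f, z ∈ D.L.lattice :=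
    CDivisionNeron.periodLatticeGamma1_le_lattice_of_forall_gamma1 D (h250 W D)
  obtain ⟨w, hw, hzw⟩ := hopt z (hle z hz)
  obtain ⟨k, hk⟩ := h2
  have hc : D.c = 2 * k := hk
  refine ⟨(k : ℂ) * w, ?_, ?_⟩
  · simpa [zsmul_eq_mul] using (periodLattice D.f).zsmul_mem hw k
  · rw [hzw, hc]
    push_cast
    ring

/-- **R₂ ⟸ CDT** by name (composition of the two previous facts with the cell's `gamma1PeriodsInNeronLattice_of_CDTInt`). -/
theorem halfManinForcesGamma1InsideTwice_of_CDT (hCDT : CalegariDimitrovTang2025_unboundedDenominators) :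
    HalfManinForcesGamma1InsideTwice :=
  halfManinForcesGamma1InsideTwice_of_gamma1PeriodsInNeronLattice (CDivisionInt.gamma1PeriodsInNeronLattice_of_CDTInt hCDT)

/-! ## §3 The printed CDT-free regime of C2 (Česnavičius–Neururer–Saha Thm 1.2 as a hypothesis) -/

/-- **C2 in print, CDT-free, for ODD modular degree**: for a datum at conductor level `N = N_W` with `2³ ∤ N` (so the printed exceptional
clause at `p = 2` cannot apply), `c ≠ 0` and `deg φ` odd, the ČNS valuation bound `v₂(c) ≤ v₂(deg φ) = 0` forces `2 ∤ c`.  This is the whole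
printed CDT-free foothold on C2's regime `v₂(N) = 2` (nothing for even `deg φ`).  CONDITIONAL on the named ČNS fact; nothing else used.
[cite: CesnaviciusNeururerSaha2023, Thm. 1.2] -/
theorem not_two_dvd_maninConstant_of_odd_modularDegree_of_CNS
    (hCNS : cesnaviciusNeururerSaha_padicVal_maninConstant_le_modularDegree)
    (W : WeierstrassCurve ℚ) [W.IsElliptic] [W.IsGloballyMinimal] [NeZero (W.conductorNorm ℤ)]
    (D : ModularParametrizationData W (W.conductorNorm ℤ)) (h8 : ¬ 2 ^ 3 ∣ W.conductorNorm ℤ)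
    (hc : D.maninConstant ≠ 0) (hodd : Odd D.modularDegree) : ¬ (2 : ℤ) ∣ D.maninConstant := by
  have hv : padicValInt 2 D.maninConstant ≤ padicValNat 2 D.modularDegree :=
    hCNS W D 2 Nat.prime_two (fun h ↦ h8 h.2.1) (fun h ↦ absurd h.1 (by norm_num))
  have hdeg : padicValNat 2 D.modularDegree = 0 :=
    padicValNat.eq_zero_of_not_dvd (fun h ↦ (Nat.not_even_iff_odd.mpr hodd) (even_iff_two_dvd.mpr h))
  rw [hdeg, Nat.le_zero] at hv
  intro h2
  have := (padicValInt_dvd_iff (p := 2) 1 D.maninConstant).mp (by simpa using h2)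
  omega

end Summit.BirchSwinnertonDyer.BirchSwinnertonDyer.Cruxes.ManinOddAtFour.DualResidualG43

end
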